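import Summits.QuantumFields.YangMills.Theorems.FluctuationComparisonRegPrIntLS2BetaRelGaugeOfRelativeLetter
import HarnessLib

/-!
# S2β · strata residue of GAP♯∘ — THE STAGE-AXIAL GAUGE CONDITION `AxStage` OF THE REL-TEL ROAD, FOR px16 g21's GAUGE-CONDITIONED LETTERS (v3,
# `…S2BetaStrataOfAxialLetters.gapStratum_of_axialLetters (G) (Ax) (hAX) (hD) (hF)`): (AX-stage) IS A THEOREM, and (D-stage) ⟸ the two-tower letter
# {(L♭), (H♭)} over the geodesic hat lift — ✓p822621's dock run WITH THE WITNESS TOWERS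

Cell `ym3-torus` (rung R3 = continuum `SU(2)` Yang–Mills on T³ — NOT d = 4, NOT infinite volume, NOT a mass gap, NOT Clay).  Width seat «width 12» `ym3-torus-px12`
(gen 24), FREE px helper on crux `stmt-QuantumFields-20520`; `--kind proof --supports … --as helper`, count-neutral, DEFINITION-FREE (0 `def`∕`instance`∕`notation`∕`sorry`).

WHAT (px16 g21 ‼ (7) + 12:38:13Z «post the PREDICATE your ✓p822621 exit satisfies + its (AX-stage) existence»).  THE PREDICATE, spelled inline
(def-free) as the `Ax` argument of (7): `AxStage F J K hJK U U₀′ :≡ ∃ wt lift U₁ g g₀, ⟨hat weights ∕ hat lift formulas⟩ ∧ ⟨the six stage-tower facts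
(T0)–(T5) of ✓`exists_stageGaugeTower` for (g, U)⟩ ∧ ⟨the six for (g₀, U₁)⟩ ∧ ⟨(T6) for g, (T5-res) for g₀⟩ ∧ U₀′ = (g_0⁻¹·g₀_0)•U₁` — «`U₀′` is the
bottom-relative re-gauging of a fibre mate `U₁` by the two stage towers» (one common gauge `h := g_0` puts `h•U`, `h•U₀′` at the two stage-comb-axial
tower bottoms, so (F-stage)∕AVG₂-stage may be proved for two FULL stage-axial towers; `LIN`, `REL`, `d²` are `h`-invariant, ✓p822838 §1).
* §1 ★★ `dockRel_of_towers` — ✓p822621 `dockRel_inner` with GIVEN towers (its proof uses only (T1)×2, (T6), (T5-res) and the letter instance).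
* §2 ★★★ `axStage_exists` — (AX-stage) = (7)'s `hAX` with `Ax := AxStage`: FREE (✓`exists_stageGaugeTower` ×2 + the residual exit).
* §3 ★★★ `dStage_of_letter (G) (HL)` — (D-stage) = (7)'s `hD` with `Ax := AxStage` ⟸ the two-tower letter {(L♭) ∧ (H♭)} over the hat lift
  ((R1)-chord DISCHARGED inside by ✓p820752 at `d = 3`); `C_D = 2·(exp E·C∕(L−1))²`.  Dock cert with (7) in HOME.

HONEST SCOPE.  Plumbing over landed theorems by name; the letter `HL` and (F-stage) are HYPOTHESES; nothing of Bałaban's analysis is asserted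
([Balaban1985Variational] (4) p.278, Thm 1 (8)–(10) p.279; [Balaban1985RegularSpaces] (1.29) p.81); (H♭), (D-ax)∕(F-ax), `hIrr`, `hA`, GAP♯∘
(`stub_uniformFibreGapOrbit`), S2β, crux 20520 and `YM3TorusSU2` are NOT proved; no registered stub is closed; rung R3 = SU(2) YM₃ on T³ — NOT d = 4, NOT
infinite volume, NOT a mass gap, NOT Clay; the Yang–Mills mass gap is NOT proved.
-/

set_option autoImplicit false

noncomputable section

namespace Summit.QuantumFields.YangMills.Theorems.FluctuationComparisonRegPrIntLS2BetaStageAxialLetters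

open Finset
open scoped Real
open Literature.MathematicalPhysics.QuantumLattice (su2Quat)
open Literature.MathematicalPhysics.QuantumFieldTheory.Balaban1983to89
open T4Continuum T3ContinuumYM3Torus T3UnitScaleTilt T3TiltDescent T3LevelShift BlockAveraging
open T4CubeChartGnomonic (SU2)
open T4HaarSU2ExpChart (expPoint)
open T4ExpWindowSmallField (logVec)
open T3UnitLawDensityEML (ℰp)
open T3ConstrainedMinimiser (fibre)
open T3PrintedRegularMinimiser (minActionRegPr)
open B10Eq27TorusAxialLog (rel axialT)
open Summit.QuantumFields.YangMills.Theorems.FluctuationComparisonRegPrIntLS2BetaStageGaugeTower (exists_stageGaugeTower)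
open Summit.QuantumFields.YangMills.Theorems.FluctuationComparisonRegPrIntLS2BetaArcBondSplit (sqrt_sum_sq_le_of_le_add)
open Summit.QuantumFields.YangMills.Theorems.FluctuationComparisonRegPrIntLS2BetaSqrtLRecursion (recursion_varRatio_sqrtL_le hFlat_currency_of_recursion')
open Summit.QuantumFields.YangMills.Theorems.FluctuationComparisonRegPrIntLS2BetaWhitneyHatLiftRelative (sum_dist1_sq_lift_mul_inv_le)
open Summit.QuantumFields.YangMills.Theorems.FluctuationComparisonRegPrIntLS2BetaHFlatOfRelativeLetter (residual_of_iter_eq)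
open Summit.QuantumFields.YangMills.Theorems.FluctuationComparisonRegPrIntLS2BetaResidualGauge (gaugeAct_mul_eq gaugeAct_mem_argmin_iff_of_residual)
open Summit.QuantumFields.YangMills.Theorems.FluctuationComparisonRegPrIntLS2BetaClosePairOfOneStep (iter_eq_of_mem_fibre)
open Summit.QuantumFields.YangMills.Theorems.FluctuationComparisonRegPrIntLS2BetaRelGaugeOfRelativeLetter
  (dist1_gaugeAct_mul_inv_gaugeAct dist1_rel_plaqHol_gaugeAct_pair dist1_mul_inv_le_flap_add_lift sum_dist1_sq_eq_two_mul_sum_one_sub_reTr)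

variable (F : T3Family) {J K : ℕ}

/-- ★★ **REL-TEL DOCK WITH THE WITNESS TOWERS** (✓p822621 `dockRel_inner`, towers as INPUT): for a fibre pair `U, U₀`, a lift with (R1)-chord, gauge
families `g, g₀` trivial above `K − J` with `g_0⁻¹` and `g₀_0` acting trivially on `M^{K−J}`, and the two-tower letter {(L♭) ∧ (H♭)} FOR THESE TOWERS:
`w := g_0⁻¹·g₀_0` is residual and `N⁻²·d²(U, w•U₀) ≤ 2·(exp E·C∕(L−1))²·REL(U; w•U₀)`.
[cite: Balaban1985RegularSpaces, (1.29) p.81; Balaban1985Variational, (4) p.278; Balaban1984PropagatorsI, Prop. 1.1 (1.89)-(1.90) p.33] -/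
theorem dockRel_of_towers (hJK : J ≤ K) (hL : 1 < (F.L : ℝ)) {V : GaugeField (F.P J) 0 SU2}
    (U U₀ : GaugeField (F.P K) 0 SU2) (hU : U ∈ fibre F ℰp J K hJK V) (hU₀ : U₀ ∈ fibre F ℰp J K hJK V)
    (lift : (j : ℕ) → GaugeField (F.P K) (j + 1) SU2 → GaugeField (F.P K) j SU2)
    (hR1 : ∀ j, j < K - J → ∀ X X' : GaugeField (F.P K) (j + 1) SU2,
      ∑ b, dist1 (lift j X b * (lift j X' b)⁻¹) ^ 2 ≤ (F.L : ℝ) * ∑ e, ‖logVec (su2Quat (X e)) - logVec (su2Quat (X' e))‖ ^ 2)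
    (C E : ℝ) (hC : 0 < C) (g g₀ : (j : ℕ) → Site (F.P K) j → SU2)
    (hT1 : ∀ j, K - J ≤ j → ∀ y, g j y = 1) (hT1' : ∀ j, K - J ≤ j → ∀ y, g₀ j y = 1)
    (hT6 : ∀ X : GaugeField (F.P K) 0 SU2, Averaging.iter (fun k => blockAvg (P := F.P K) (j := k) ℰp) (K - J) (GaugeField.gaugeAct (fun x => (g 0 x)⁻¹) X) = Averaging.iter (fun k => blockAvg (P := F.P K) (j := k) ℰp) (K - J) X)
    (hres' : ∀ X : GaugeField (F.P K) 0 SU2, Averaging.iter (fun k => blockAvg (P := F.P K) (j := k) ℰp) (K - J) (GaugeField.gaugeAct (g₀ 0) X) = Averaging.iter (fun k => blockAvg (P := F.P K) (j := k) ℰp) (K - J) X)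
    (hH :
      ∃ r e : ℕ → ℝ, (∀ j, 0 ≤ r j) ∧ (∀ j, 0 ≤ e j) ∧ ∑ j ∈ range (K - J), (r j + e j) ≤ E ∧
        ∀ j, j < K - J →
          √(∑ b, ‖logVec (su2Quat (GaugeField.gaugeAct (g (j + 1)) (Averaging.iter (fun k => blockAvg (P := F.P K) (j := k) ℰp) (j + 1) U) b)) -
                logVec (su2Quat (GaugeField.gaugeAct (g₀ (j + 1)) (Averaging.iter (fun k => blockAvg (P := F.P K) (j := k) ℰp) (j + 1) U₀) b))‖ ^ 2) ≤
            (1 + r j) * √(∑ b, dist1 (GaugeField.gaugeAct (g (j + 1)) (Averaging.iter (fun k => blockAvg (P := F.P K) (j := k) ℰp) (j + 1) U) b *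
              (GaugeField.gaugeAct (g₀ (j + 1)) (Averaging.iter (fun k => blockAvg (P := F.P K) (j := k) ℰp) (j + 1) U₀) b)⁻¹) ^ 2) ∧
          √(∑ b, dist1 (GaugeField.gaugeAct (g j) (Averaging.iter (fun k => blockAvg (P := F.P K) (j := k) ℰp) j U) b *
                (lift j (GaugeField.gaugeAct (g (j + 1)) (Averaging.iter (fun k => blockAvg (P := F.P K) (j := k) ℰp) (j + 1) U)) b)⁻¹ *
              (GaugeField.gaugeAct (g₀ j) (Averaging.iter (fun k => blockAvg (P := F.P K) (j := k) ℰp) j U₀) b *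
                (lift j (GaugeField.gaugeAct (g₀ (j + 1)) (Averaging.iter (fun k => blockAvg (P := F.P K) (j := k) ℰp) (j + 1) U₀)) b)⁻¹)⁻¹) ^ 2) ≤
            Real.sqrt (F.L : ℝ) * e j * √(∑ b, dist1 (GaugeField.gaugeAct (g (j + 1)) (Averaging.iter (fun k => blockAvg (P := F.P K) (j := k) ℰp) (j + 1) U) b *
              (GaugeField.gaugeAct (g₀ (j + 1)) (Averaging.iter (fun k => blockAvg (P := F.P K) (j := k) ℰp) (j + 1) U₀) b)⁻¹) ^ 2) +
              C * Real.sqrt (F.L : ℝ) ^ j *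
                √(∑ p, dist1 ((GaugeField.plaqHol (GaugeField.gaugeAct (g₀ 0) U₀) p)⁻¹ * GaugeField.plaqHol (GaugeField.gaugeAct (g 0) U) p) ^ 2)) :
    (∀ U' : GaugeField (F.P K) 0 SU2, descendTo F ℰp J K hJK (GaugeField.gaugeAct (fun x => (g 0 x)⁻¹ * g₀ 0 x) U') = descendTo F ℰp J K hJK U') ∧
      ((F.L : ℝ)⁻¹) ^ (2 * (K - J)) * ∑ ℓ : PBond (F.P K) 0, dist1 (U ℓ * ((GaugeField.gaugeAct (fun x => (g 0 x)⁻¹ * g₀ 0 x) U₀) ℓ)⁻¹) ^ 2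
        ≤ 2 * (Real.exp E * C / (F.L - 1)) ^ 2 *
          ∑ p : Plaq (F.P K) 0, (1 - reTr ((GaugeField.plaqHol (GaugeField.gaugeAct (fun x => (g 0 x)⁻¹ * g₀ 0 x) U₀) p)⁻¹ * GaugeField.plaqHol U p)) := by
  set av : ∀ i, Averaging (F.P K) i SU2 := fun k => blockAvg (P := F.P K) (j := k) ℰp with hav
  obtain ⟨r, e, hr0, he0, hE, hH⟩ := hH
  set B : ℕ → ℝ := fun j => √(∑ b, dist1 (GaugeField.gaugeAct (g j) (Averaging.iter av j U) b *
      (GaugeField.gaugeAct (g₀ j) (Averaging.iter av j U₀) b)⁻¹) ^ 2) with hB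
  set S : ℝ := √(∑ p, dist1 ((GaugeField.plaqHol (GaugeField.gaugeAct (g₀ 0) U₀) p)⁻¹ *
      GaugeField.plaqHol (GaugeField.gaugeAct (g 0) U) p) ^ 2) with hS
  have hB0 : ∀ j, 0 ≤ B j := fun j => Real.sqrt_nonneg _
  have htop : B (K - J) = 0 := by
    have h1 : Averaging.iter av (K - J) U = Averaging.iter av (K - J) U₀ := iter_eq_of_mem_fibre F hJK hU hU₀
    have hg : g (K - J) = fun _ => 1 := funext (hT1 (K - J) le_rfl)
    have hg' : g₀ (K - J) = fun _ => 1 := funext (hT1' (K - J) le_rfl)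
    simp only [hB, h1, hg, hg', mul_inv_cancel, GaugeGroup.dist1_one, ne_eq, OfNat.ofNat_ne_zero, not_false_eq_true, zero_pow,
      sum_const_zero, Real.sqrt_zero]
  have hrec : ∀ j, j < K - J → B j ≤ Real.sqrt (F.L : ℝ) * (1 + (r j + e j)) * B (j + 1) + C * Real.sqrt (F.L : ℝ) ^ j * S := by
    intro j hj
    obtain ⟨hLj, hHj⟩ := hH j hj
    have hsplit := sqrt_sum_sq_le_of_le_add (univ : Finset (PBond (F.P K) j)) (fun b _ => GaugeGroup.dist1_nonneg _)
      (fun b _ => dist1_mul_inv_le_flap_add_lift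
        (GaugeField.gaugeAct (g j) (Averaging.iter av j U) b)
        (lift j (GaugeField.gaugeAct (g (j + 1)) (Averaging.iter av (j + 1) U)) b)
        (GaugeField.gaugeAct (g₀ j) (Averaging.iter av j U₀) b)
        (lift j (GaugeField.gaugeAct (g₀ (j + 1)) (Averaging.iter av (j + 1) U₀)) b))
    have hlift : √(∑ b, dist1 (lift j (GaugeField.gaugeAct (g (j + 1)) (Averaging.iter av (j + 1) U)) b *
        (lift j (GaugeField.gaugeAct (g₀ (j + 1)) (Averaging.iter av (j + 1) U₀)) b)⁻¹) ^ 2) ≤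
        Real.sqrt (F.L : ℝ) * ((1 + r j) * B (j + 1)) := by
      refine (Real.sqrt_le_sqrt (hR1 j hj _ _)).trans ?_
      rw [Real.sqrt_mul (Nat.cast_nonneg _)]
      exact mul_le_mul_of_nonneg_left hLj (Real.sqrt_nonneg _)
    calc B j ≤ _ := hsplit
      _ ≤ (Real.sqrt (F.L : ℝ) * e j * B (j + 1) + C * Real.sqrt (F.L : ℝ) ^ j * S) + Real.sqrt (F.L : ℝ) * ((1 + r j) * B (j + 1)) :=
          add_le_add hHj hlift
      _ = Real.sqrt (F.L : ℝ) * (1 + (r j + e j)) * B (j + 1) + C * Real.sqrt (F.L : ℝ) ^ j * S := by ring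
  have hsol := recursion_varRatio_sqrtL_le (F.L : ℝ) hL B (fun j => C * Real.sqrt (F.L : ℝ) ^ j * S) (fun j => r j + e j) (K - J) htop
    (fun j => add_nonneg (hr0 j) (he0 j)) E hE hrec C S hC.le (Real.sqrt_nonneg _) (fun t _ => le_rfl)
  have hC' : 0 < Real.exp E * C := mul_pos (Real.exp_pos E) hC
  have hL1 : 0 < (F.L : ℝ) - 1 := by linarith
  have hsol' : B 0 ≤ Real.exp E * C * S * ((F.L : ℝ) ^ (K - J) / ((F.L : ℝ) - 1)) := by
    refine hsol.trans (mul_le_mul_of_nonneg_left (div_le_div_of_nonneg_right (by linarith) hL1.le) ?_)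
    exact mul_nonneg hC'.le (Real.sqrt_nonneg _)
  have hcur := hFlat_currency_of_recursion' (F.L : ℝ) (Real.exp E * C) S (B 0) (K - J) hL hC' (hB0 0) hsol'
  refine ⟨?_, ?_⟩
  · refine residual_of_iter_eq F hJK _ fun X => ?_
    have e1 : GaugeField.gaugeAct (fun x => (g 0 x)⁻¹ * g₀ 0 x) X =
        GaugeField.gaugeAct (fun x => (g 0 x)⁻¹) (GaugeField.gaugeAct (g₀ 0) X) := by
      rw [← gaugeAct_mul_eq]; rfl
    rw [e1, hT6, hres']
  · have hd : ∑ ℓ : PBond (F.P K) 0, dist1 (U ℓ * ((GaugeField.gaugeAct (fun x => (g 0 x)⁻¹ * g₀ 0 x) U₀) ℓ)⁻¹) ^ 2 = B 0 ^ 2 := by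
      rw [hB, Real.sq_sqrt (sum_nonneg fun _ _ => sq_nonneg _)]
      exact sum_congr rfl fun ℓ _ => by rw [← dist1_gaugeAct_mul_inv_gaugeAct]; rfl
    have hSq : S ^ 2 = 2 * ∑ p : Plaq (F.P K) 0,
        (1 - reTr ((GaugeField.plaqHol (GaugeField.gaugeAct (fun x => (g 0 x)⁻¹ * g₀ 0 x) U₀) p)⁻¹ * GaugeField.plaqHol U p)) := by
      rw [hS, Real.sq_sqrt (sum_nonneg fun _ _ => sq_nonneg _), ← sum_dist1_sq_eq_two_mul_sum_one_sub_reTr]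
      exact sum_congr rfl fun p _ => by rw [dist1_rel_plaqHol_gaugeAct_pair]
    have hk : 0 < ((F.L : ℝ) - 1) / (Real.exp E * C) := div_pos hL1 hC'
    have h1 : ((F.L : ℝ)⁻¹) ^ (2 * (K - J)) * B 0 ^ 2 ≤ S ^ 2 / (((F.L : ℝ) - 1) / (Real.exp E * C)) ^ 2 := by
      rw [le_div_iff₀ (pow_pos hk 2)]
      calc ((F.L : ℝ)⁻¹) ^ (2 * (K - J)) * B 0 ^ 2 * (((F.L : ℝ) - 1) / (Real.exp E * C)) ^ 2
          = (((F.L : ℝ) - 1) / (Real.exp E * C)) ^ 2 * ((F.L : ℝ)⁻¹) ^ (2 * (K - J)) * B 0 ^ 2 := by ring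
        _ ≤ S ^ 2 := hcur
    have h2 : S ^ 2 / (((F.L : ℝ) - 1) / (Real.exp E * C)) ^ 2 = (Real.exp E * C / ((F.L : ℝ) - 1)) ^ 2 * S ^ 2 := by
      rw [div_pow, div_pow, div_div_eq_mul_div]
      field_simp
    rw [hd]
    calc ((F.L : ℝ)⁻¹) ^ (2 * (K - J)) * B 0 ^ 2
        ≤ (Real.exp E * C / ((F.L : ℝ) - 1)) ^ 2 * S ^ 2 := h1.trans_eq h2
      _ = 2 * (Real.exp E * C / (F.L - 1)) ^ 2 * ∑ p : Plaq (F.P K) 0,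
            (1 - reTr ((GaugeField.plaqHol (GaugeField.gaugeAct (fun x => (g 0 x)⁻¹ * g₀ 0 x) U₀) p)⁻¹ * GaugeField.plaqHol U p)) := by
          rw [hSq]; ring

/-- ★★★ **(AX-stage) IS A THEOREM** — (7)'s `hAX` with `Ax := AxStage` (spelled inline): two stage towers over the geodesic hat lift
(✓`exists_stageGaugeTower` ×2) and the residual relative gauge `w := g_0⁻¹·g₀_0`; the witness fibre mate is `U₀` itself.
[cite: Balaban1985Variational, (4) p.278; Balaban1985RegularSpaces, (1.29) p.81] -/
theorem axStage_exists (G : (F : T3Family) → (J : ℕ) → GaugeField (F.P J) 0 (Matrix.specialUnitaryGroup (Fin 2) ℂ) → Prop) :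
    ∀ (L : ℕ), ∃ c₀ : ℝ, 0 < c₀ ∧ c₀ ≤ 1 ∧ ∀ (cw : ℝ), 0 < cw → cw ≤ c₀ → ∃ pS : ℝ, ∀ (b₀ p₀ : ℝ), 0 < b₀ → pS ≤ p₀ → 0 < p₀ → ∃ ε₁ : ℝ, 0 < ε₁ ∧ ∀ (ε₀ : ℝ), 0 < ε₀ → ε₀ ≤ ε₁ →
    ∃ γ₁ : ℝ, 0 < γ₁ ∧ ∀ (F : T3Family) (γ : ℝ), F.L = L → 0 < γ → γ ≤ γ₁ →
      ∀ (J K : ℕ) (hJK : J ≤ K) (V : GaugeField (F.P J) 0 (Matrix.specialUnitaryGroup (Fin 2) ℂ)), PlaqSmall (θBal F.L γ (cw * b₀) p₀ J) V →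
        G F J V →
        ∀ U₀ ∈ {U' : GaugeField (F.P K) 0 (Matrix.specialUnitaryGroup (Fin 2) ℂ) | U' ∈ fibre F ℰp J K hJK V ∧ U' ∈ histGood F ℰp (θBal F.L γ b₀ p₀) K J ∧
            wilsonAction4 U' = minActionRegPr F J K hJK ε₀ V},
        ∀ U ∈ fibre F ℰp J K hJK V, U ∈ histGood F ℰp (θBal F.L γ b₀ p₀) K J →
        ∃ w : GaugeTransf (F.P K) 0 (Matrix.specialUnitaryGroup (Fin 2) ℂ),
          (∀ U' : GaugeField (F.P K) 0 (Matrix.specialUnitaryGroup (Fin 2) ℂ),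
            descendTo F ℰp J K hJK (GaugeField.gaugeAct w U') = descendTo F ℰp J K hJK U') ∧
          ∃ (wt : (j : ℕ) → PBond (F.P K) j → PBond (F.P K) (j + 1) → ℝ)
            (lift : (j : ℕ) → GaugeField (F.P K) (j + 1) SU2 → GaugeField (F.P K) j SU2)
            (U₁ : GaugeField (F.P K) 0 SU2) (g g₀ : (j : ℕ) → Site (F.P K) j → SU2),
          (∀ j b e, wt j b e = if e.dir = b.dir ∧ (b.src b.dir - emb e.src b.dir).val < (F.P K).L then
              ∏ ν ∈ Finset.univ.erase b.dir, max 0 (1 - ((rel (emb e.src) b.src ν).natAbs : ℝ) / (F.P K).L) else 0) ∧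
          (∀ j X b, lift j X b = expPoint (∑ e, wt j b e • ((((F.P K).L : ℕ) : ℝ)⁻¹ • logVec (su2Quat (X e))))) ∧
          (∀ j, j < K - J → ∀ x, g j x =
            (axialT (lift j (GaugeField.gaugeAct (g (j + 1)) (Averaging.iter (fun k => blockAvg (P := F.P K) (j := k) ℰp) (j + 1) U)))
                (emb (blockOf x)) x)⁻¹ *
              g (j + 1) (blockOf x) * axialT (Averaging.iter (fun k => blockAvg (P := F.P K) (j := k) ℰp) j U) (emb (blockOf x)) x) ∧
          (∀ j, K - J ≤ j → ∀ y, g j y = 1) ∧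
          (∀ j, j < K - J → ∀ y : Site (F.P K) (j + 1), g j (emb y) = g (j + 1) y) ∧
          (∀ X : GaugeField (F.P K) 0 SU2, ∀ j, j ≤ K - J →
            Averaging.iter (fun k => blockAvg (P := F.P K) (j := k) ℰp) j (GaugeField.gaugeAct (g 0) X) =
              GaugeField.gaugeAct (g j) (Averaging.iter (fun k => blockAvg (P := F.P K) (j := k) ℰp) j X)) ∧
          (∀ j, j < K - J → ∀ x,
            axialT (GaugeField.gaugeAct (g j) (Averaging.iter (fun k => blockAvg (P := F.P K) (j := k) ℰp) j U)) (emb (blockOf x)) x =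
              axialT (lift j (GaugeField.gaugeAct (g (j + 1)) (Averaging.iter (fun k => blockAvg (P := F.P K) (j := k) ℰp) (j + 1) U)))
                (emb (blockOf x)) x) ∧
          (∀ j, j < K - J →
            (blockAvg (P := F.P K) (j := j) ℰp).avg (GaugeField.gaugeAct (g j) (Averaging.iter (fun k => blockAvg (P := F.P K) (j := k) ℰp) j U)) =
              GaugeField.gaugeAct (g (j + 1)) (Averaging.iter (fun k => blockAvg (P := F.P K) (j := k) ℰp) (j + 1) U)) ∧
          (∀ j, j < K - J → ∀ x, g₀ j x =
            (axialT (lift j (GaugeField.gaugeAct (g₀ (j + 1)) (Averaging.iter (fun k => blockAvg (P := F.P K) (j := k) ℰp) (j + 1) U₁)))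
                (emb (blockOf x)) x)⁻¹ *
              g₀ (j + 1) (blockOf x) * axialT (Averaging.iter (fun k => blockAvg (P := F.P K) (j := k) ℰp) j U₁) (emb (blockOf x)) x) ∧
          (∀ j, K - J ≤ j → ∀ y, g₀ j y = 1) ∧
          (∀ j, j < K - J → ∀ y : Site (F.P K) (j + 1), g₀ j (emb y) = g₀ (j + 1) y) ∧
          (∀ X : GaugeField (F.P K) 0 SU2, ∀ j, j ≤ K - J →
            Averaging.iter (fun k => blockAvg (P := F.P K) (j := k) ℰp) j (GaugeField.gaugeAct (g₀ 0) X) =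
              GaugeField.gaugeAct (g₀ j) (Averaging.iter (fun k => blockAvg (P := F.P K) (j := k) ℰp) j X)) ∧
          (∀ j, j < K - J → ∀ x,
            axialT (GaugeField.gaugeAct (g₀ j) (Averaging.iter (fun k => blockAvg (P := F.P K) (j := k) ℰp) j U₁)) (emb (blockOf x)) x =
              axialT (lift j (GaugeField.gaugeAct (g₀ (j + 1)) (Averaging.iter (fun k => blockAvg (P := F.P K) (j := k) ℰp) (j + 1) U₁)))
                (emb (blockOf x)) x) ∧
          (∀ j, j < K - J →
            (blockAvg (P := F.P K) (j := j) ℰp).avg (GaugeField.gaugeAct (g₀ j) (Averaging.iter (fun k => blockAvg (P := F.P K) (j := k) ℰp) j U₁)) =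
              GaugeField.gaugeAct (g₀ (j + 1)) (Averaging.iter (fun k => blockAvg (P := F.P K) (j := k) ℰp) (j + 1) U₁)) ∧
          (∀ X : GaugeField (F.P K) 0 SU2, Averaging.iter (fun k => blockAvg (P := F.P K) (j := k) ℰp) (K - J) (GaugeField.gaugeAct (fun x => (g 0 x)⁻¹) X) = Averaging.iter (fun k => blockAvg (P := F.P K) (j := k) ℰp) (K - J) X) ∧
          (∀ X : GaugeField (F.P K) 0 SU2, Averaging.iter (fun k => blockAvg (P := F.P K) (j := k) ℰp) (K - J) (GaugeField.gaugeAct (g₀ 0) X) = Averaging.iter (fun k => blockAvg (P := F.P K) (j := k) ℰp) (K - J) X) ∧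
          (GaugeField.gaugeAct w U₀ : GaugeField (F.P K) 0 SU2) = GaugeField.gaugeAct (fun x => (g 0 x)⁻¹ * g₀ 0 x) U₁ := by
  intro L
  refine ⟨1, one_pos, le_rfl, fun cw _ _ => ⟨0, fun b₀ p₀ _ _ _ => ⟨1, one_pos, fun ε₀ _ _ => ⟨1, one_pos, ?_⟩⟩⟩⟩
  intro F γ _ _ _ J K hJK V _ _ U₀ _ U _ _
  have hm : K - J ≤ (F.P K).m + (F.P K).K := by show K - J ≤ F.m + K; omega
  set av : ∀ i, Averaging (F.P K) i SU2 := fun k => blockAvg (P := F.P K) (j := k) ℰp with hav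
  obtain ⟨wt, hwt⟩ : ∃ f : (j : ℕ) → PBond (F.P K) j → PBond (F.P K) (j + 1) → ℝ, f = fun j b e =>
      if e.dir = b.dir ∧ (b.src b.dir - emb e.src b.dir).val < (F.P K).L then
          ∏ ν ∈ Finset.univ.erase b.dir, max 0 (1 - ((rel (emb e.src) b.src ν).natAbs : ℝ) / (F.P K).L) else 0 := ⟨_, rfl⟩
  obtain ⟨lift, hlift⟩ : ∃ f : (j : ℕ) → GaugeField (F.P K) (j + 1) SU2 → GaugeField (F.P K) j SU2,
      f = fun j X b => expPoint (∑ e, wt j b e • ((((F.P K).L : ℕ) : ℝ)⁻¹ • logVec (su2Quat (X e)))) := ⟨_, rfl⟩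
  obtain ⟨g, hT0, hT1, hT2, hT3, hres, hT6, hT4, hT5⟩ := exists_stageGaugeTower av hm lift U
  obtain ⟨g₀, hT0', hT1', hT2', hT3', hres', hT6', hT4', hT5'⟩ := exists_stageGaugeTower av hm lift U₀
  have hwres : ∀ X : GaugeField (F.P K) 0 SU2,
      descendTo F ℰp J K hJK (GaugeField.gaugeAct (fun x => (g 0 x)⁻¹ * g₀ 0 x) X) = descendTo F ℰp J K hJK X := by
    refine residual_of_iter_eq F hJK _ fun X => ?_
    have e1 : GaugeField.gaugeAct (fun x => (g 0 x)⁻¹ * g₀ 0 x) X =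
        GaugeField.gaugeAct (fun x => (g 0 x)⁻¹) (GaugeField.gaugeAct (g₀ 0) X) := by
      rw [← gaugeAct_mul_eq]; rfl
    rw [e1, hT6, hres']
  exact ⟨fun x => (g 0 x)⁻¹ * g₀ 0 x, hwres, wt, lift, U₀, g, g₀, fun j b e => by rw [hwt], fun j X b => by rw [hlift],
    hT0, hT1, hT2, hT3, hT4, hT5, hT0', hT1', hT2', hT3', hT4', hT5', hT6, hres', rfl⟩

/-- ★★★ **(D-stage) FROM THE LETTER** — (7)'s `hD` with `Ax := AxStage` ⟸ the two-tower one-level letter {(L♭) ∧ (H♭)} over the geodesic hat lift, in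
`hD`'s own prefix (`∃ γ₁ ∃ E ∃ C`): unpack the `AxStage` witness `(wt, lift, U₁, g, g₀)`, move the argmin to the fibre mate `U₁ = w⁻¹•U₀`
(✓`gaugeAct_mem_argmin_iff_of_residual`), read the letter there, and run §1 with the witness towers — the pair `(U, w•U₁) = (U, U₀)`; (R1)-chord is
✓p820752 at `d = 3`; `C_D = 2·(exp E·C∕(L−1))²`. [cite: Balaban1985Variational, Thm 1 (8)-(10) p.279, (4) p.278; Balaban1985RegularSpaces, (1.29) p.81] -/
theorem dStage_of_letter (G : (F : T3Family) → (J : ℕ) → GaugeField (F.P J) 0 (Matrix.specialUnitaryGroup (Fin 2) ℂ) → Prop)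
    (HL : ∀ (L : ℕ), ∃ c₀ : ℝ, 0 < c₀ ∧ c₀ ≤ 1 ∧ ∀ (cw : ℝ), 0 < cw → cw ≤ c₀ → ∃ pS : ℝ, ∀ (b₀ p₀ : ℝ), 0 < b₀ → pS ≤ p₀ → 0 < p₀ → ∃ ε₁ : ℝ, 0 < ε₁ ∧ ∀ (ε₀ : ℝ), 0 < ε₀ → ε₀ ≤ ε₁ →
      ∃ γ₁ : ℝ, 0 < γ₁ ∧ ∃ E C : ℝ, 0 < C ∧ ∀ (F : T3Family) (γ : ℝ), F.L = L → 0 < γ → γ ≤ γ₁ →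
        ∀ (J K : ℕ) (hJK : J ≤ K) (V : GaugeField (F.P J) 0 (Matrix.specialUnitaryGroup (Fin 2) ℂ)), PlaqSmall (θBal F.L γ (cw * b₀) p₀ J) V →
          G F J V →
          ∀ U₀ ∈ {U' : GaugeField (F.P K) 0 (Matrix.specialUnitaryGroup (Fin 2) ℂ) | U' ∈ fibre F ℰp J K hJK V ∧ U' ∈ histGood F ℰp (θBal F.L γ b₀ p₀) K J ∧
              wilsonAction4 U' = minActionRegPr F J K hJK ε₀ V},
          ∀ U ∈ fibre F ℰp J K hJK V, U ∈ histGood F ℰp (θBal F.L γ b₀ p₀) K J →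
          ∀ (wt : (j : ℕ) → PBond (F.P K) j → PBond (F.P K) (j + 1) → ℝ)
            (lift : (j : ℕ) → GaugeField (F.P K) (j + 1) SU2 → GaugeField (F.P K) j SU2),
            (∀ j b e, wt j b e = if e.dir = b.dir ∧ (b.src b.dir - emb e.src b.dir).val < (F.P K).L then
                ∏ ν ∈ Finset.univ.erase b.dir, max 0 (1 - ((rel (emb e.src) b.src ν).natAbs : ℝ) / (F.P K).L) else 0) →
            (∀ j X b, lift j X b = expPoint (∑ e, wt j b e • ((((F.P K).L : ℕ) : ℝ)⁻¹ • logVec (su2Quat (X e))))) →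
          ∀ g g₀ : (j : ℕ) → Site (F.P K) j → SU2,
            (∀ j, j < K - J → ∀ x, g j x =
              (axialT (lift j (GaugeField.gaugeAct (g (j + 1)) (Averaging.iter (fun k => blockAvg (P := F.P K) (j := k) ℰp) (j + 1) U)))
                  (emb (blockOf x)) x)⁻¹ *
                g (j + 1) (blockOf x) * axialT (Averaging.iter (fun k => blockAvg (P := F.P K) (j := k) ℰp) j U) (emb (blockOf x)) x) →
            (∀ j, K - J ≤ j → ∀ y, g j y = 1) →
            (∀ j, j < K - J → ∀ y : Site (F.P K) (j + 1), g j (emb y) = g (j + 1) y) →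
            (∀ X : GaugeField (F.P K) 0 SU2, ∀ j, j ≤ K - J →
              Averaging.iter (fun k => blockAvg (P := F.P K) (j := k) ℰp) j (GaugeField.gaugeAct (g 0) X) =
                GaugeField.gaugeAct (g j) (Averaging.iter (fun k => blockAvg (P := F.P K) (j := k) ℰp) j X)) →
            (∀ j, j < K - J → ∀ x,
              axialT (GaugeField.gaugeAct (g j) (Averaging.iter (fun k => blockAvg (P := F.P K) (j := k) ℰp) j U)) (emb (blockOf x)) x =
                axialT (lift j (GaugeField.gaugeAct (g (j + 1)) (Averaging.iter (fun k => blockAvg (P := F.P K) (j := k) ℰp) (j + 1) U)))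
                  (emb (blockOf x)) x) →
            (∀ j, j < K - J →
              (blockAvg (P := F.P K) (j := j) ℰp).avg (GaugeField.gaugeAct (g j) (Averaging.iter (fun k => blockAvg (P := F.P K) (j := k) ℰp) j U)) =
                GaugeField.gaugeAct (g (j + 1)) (Averaging.iter (fun k => blockAvg (P := F.P K) (j := k) ℰp) (j + 1) U)) →
            (∀ j, j < K - J → ∀ x, g₀ j x =
              (axialT (lift j (GaugeField.gaugeAct (g₀ (j + 1)) (Averaging.iter (fun k => blockAvg (P := F.P K) (j := k) ℰp) (j + 1) U₀)))
                  (emb (blockOf x)) x)⁻¹ *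
                g₀ (j + 1) (blockOf x) * axialT (Averaging.iter (fun k => blockAvg (P := F.P K) (j := k) ℰp) j U₀) (emb (blockOf x)) x) →
            (∀ j, K - J ≤ j → ∀ y, g₀ j y = 1) →
            (∀ j, j < K - J → ∀ y : Site (F.P K) (j + 1), g₀ j (emb y) = g₀ (j + 1) y) →
            (∀ X : GaugeField (F.P K) 0 SU2, ∀ j, j ≤ K - J →
              Averaging.iter (fun k => blockAvg (P := F.P K) (j := k) ℰp) j (GaugeField.gaugeAct (g₀ 0) X) =
                GaugeField.gaugeAct (g₀ j) (Averaging.iter (fun k => blockAvg (P := F.P K) (j := k) ℰp) j X)) →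
            (∀ j, j < K - J → ∀ x,
              axialT (GaugeField.gaugeAct (g₀ j) (Averaging.iter (fun k => blockAvg (P := F.P K) (j := k) ℰp) j U₀)) (emb (blockOf x)) x =
                axialT (lift j (GaugeField.gaugeAct (g₀ (j + 1)) (Averaging.iter (fun k => blockAvg (P := F.P K) (j := k) ℰp) (j + 1) U₀)))
                  (emb (blockOf x)) x) →
            (∀ j, j < K - J →
              (blockAvg (P := F.P K) (j := j) ℰp).avg (GaugeField.gaugeAct (g₀ j) (Averaging.iter (fun k => blockAvg (P := F.P K) (j := k) ℰp) j U₀)) =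
                GaugeField.gaugeAct (g₀ (j + 1)) (Averaging.iter (fun k => blockAvg (P := F.P K) (j := k) ℰp) (j + 1) U₀)) →
            ∃ r e : ℕ → ℝ, (∀ j, 0 ≤ r j) ∧ (∀ j, 0 ≤ e j) ∧ ∑ j ∈ range (K - J), (r j + e j) ≤ E ∧
              ∀ j, j < K - J →
                √(∑ b, ‖logVec (su2Quat (GaugeField.gaugeAct (g (j + 1)) (Averaging.iter (fun k => blockAvg (P := F.P K) (j := k) ℰp) (j + 1) U) b)) -
                      logVec (su2Quat (GaugeField.gaugeAct (g₀ (j + 1)) (Averaging.iter (fun k => blockAvg (P := F.P K) (j := k) ℰp) (j + 1) U₀) b))‖ ^ 2) ≤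
                  (1 + r j) * √(∑ b, dist1 (GaugeField.gaugeAct (g (j + 1)) (Averaging.iter (fun k => blockAvg (P := F.P K) (j := k) ℰp) (j + 1) U) b *
                    (GaugeField.gaugeAct (g₀ (j + 1)) (Averaging.iter (fun k => blockAvg (P := F.P K) (j := k) ℰp) (j + 1) U₀) b)⁻¹) ^ 2) ∧
                √(∑ b, dist1 (GaugeField.gaugeAct (g j) (Averaging.iter (fun k => blockAvg (P := F.P K) (j := k) ℰp) j U) b *
                      (lift j (GaugeField.gaugeAct (g (j + 1)) (Averaging.iter (fun k => blockAvg (P := F.P K) (j := k) ℰp) (j + 1) U)) b)⁻¹ *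
                    (GaugeField.gaugeAct (g₀ j) (Averaging.iter (fun k => blockAvg (P := F.P K) (j := k) ℰp) j U₀) b *
                      (lift j (GaugeField.gaugeAct (g₀ (j + 1)) (Averaging.iter (fun k => blockAvg (P := F.P K) (j := k) ℰp) (j + 1) U₀)) b)⁻¹)⁻¹) ^ 2) ≤
                  Real.sqrt (F.L : ℝ) * e j * √(∑ b, dist1 (GaugeField.gaugeAct (g (j + 1)) (Averaging.iter (fun k => blockAvg (P := F.P K) (j := k) ℰp) (j + 1) U) b *
                    (GaugeField.gaugeAct (g₀ (j + 1)) (Averaging.iter (fun k => blockAvg (P := F.P K) (j := k) ℰp) (j + 1) U₀) b)⁻¹) ^ 2) +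
                    C * Real.sqrt (F.L : ℝ) ^ j *
                      √(∑ p, dist1 ((GaugeField.plaqHol (GaugeField.gaugeAct (g₀ 0) U₀) p)⁻¹ * GaugeField.plaqHol (GaugeField.gaugeAct (g 0) U) p) ^ 2)) :
    ∀ (L : ℕ), ∃ c₀ : ℝ, 0 < c₀ ∧ c₀ ≤ 1 ∧ ∀ (cw : ℝ), 0 < cw → cw ≤ c₀ → ∃ pS : ℝ, ∀ (b₀ p₀ : ℝ), 0 < b₀ → pS ≤ p₀ → 0 < p₀ → ∃ ε₁ : ℝ, 0 < ε₁ ∧ ∀ (ε₀ : ℝ), 0 < ε₀ → ε₀ ≤ ε₁ →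
    ∃ γ₁ : ℝ, 0 < γ₁ ∧ ∃ C_D : ℝ, 0 < C_D ∧ ∀ (F : T3Family) (γ : ℝ), F.L = L → 0 < γ → γ ≤ γ₁ →
      ∀ (J K : ℕ) (hJK : J ≤ K) (V : GaugeField (F.P J) 0 (Matrix.specialUnitaryGroup (Fin 2) ℂ)), PlaqSmall (θBal F.L γ (cw * b₀) p₀ J) V →
        G F J V →
        ∀ U₀ ∈ {U' : GaugeField (F.P K) 0 (Matrix.specialUnitaryGroup (Fin 2) ℂ) | U' ∈ fibre F ℰp J K hJK V ∧ U' ∈ histGood F ℰp (θBal F.L γ b₀ p₀) K J ∧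
            wilsonAction4 U' = minActionRegPr F J K hJK ε₀ V},
        ∀ U ∈ fibre F ℰp J K hJK V, U ∈ histGood F ℰp (θBal F.L γ b₀ p₀) K J →
        (          ∃ (wt : (j : ℕ) → PBond (F.P K) j → PBond (F.P K) (j + 1) → ℝ)
            (lift : (j : ℕ) → GaugeField (F.P K) (j + 1) SU2 → GaugeField (F.P K) j SU2)
            (U₁ : GaugeField (F.P K) 0 SU2) (g g₀ : (j : ℕ) → Site (F.P K) j → SU2),
          (∀ j b e, wt j b e = if e.dir = b.dir ∧ (b.src b.dir - emb e.src b.dir).val < (F.P K).L then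
              ∏ ν ∈ Finset.univ.erase b.dir, max 0 (1 - ((rel (emb e.src) b.src ν).natAbs : ℝ) / (F.P K).L) else 0) ∧
          (∀ j X b, lift j X b = expPoint (∑ e, wt j b e • ((((F.P K).L : ℕ) : ℝ)⁻¹ • logVec (su2Quat (X e))))) ∧
          (∀ j, j < K - J → ∀ x, g j x =
            (axialT (lift j (GaugeField.gaugeAct (g (j + 1)) (Averaging.iter (fun k => blockAvg (P := F.P K) (j := k) ℰp) (j + 1) U)))
                (emb (blockOf x)) x)⁻¹ *
              g (j + 1) (blockOf x) * axialT (Averaging.iter (fun k => blockAvg (P := F.P K) (j := k) ℰp) j U) (emb (blockOf x)) x) ∧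
          (∀ j, K - J ≤ j → ∀ y, g j y = 1) ∧
          (∀ j, j < K - J → ∀ y : Site (F.P K) (j + 1), g j (emb y) = g (j + 1) y) ∧
          (∀ X : GaugeField (F.P K) 0 SU2, ∀ j, j ≤ K - J →
            Averaging.iter (fun k => blockAvg (P := F.P K) (j := k) ℰp) j (GaugeField.gaugeAct (g 0) X) =
              GaugeField.gaugeAct (g j) (Averaging.iter (fun k => blockAvg (P := F.P K) (j := k) ℰp) j X)) ∧
          (∀ j, j < K - J → ∀ x,
            axialT (GaugeField.gaugeAct (g j) (Averaging.iter (fun k => blockAvg (P := F.P K) (j := k) ℰp) j U)) (emb (blockOf x)) x =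
              axialT (lift j (GaugeField.gaugeAct (g (j + 1)) (Averaging.iter (fun k => blockAvg (P := F.P K) (j := k) ℰp) (j + 1) U)))
                (emb (blockOf x)) x) ∧
          (∀ j, j < K - J →
            (blockAvg (P := F.P K) (j := j) ℰp).avg (GaugeField.gaugeAct (g j) (Averaging.iter (fun k => blockAvg (P := F.P K) (j := k) ℰp) j U)) =
              GaugeField.gaugeAct (g (j + 1)) (Averaging.iter (fun k => blockAvg (P := F.P K) (j := k) ℰp) (j + 1) U)) ∧
          (∀ j, j < K - J → ∀ x, g₀ j x =
            (axialT (lift j (GaugeField.gaugeAct (g₀ (j + 1)) (Averaging.iter (fun k => blockAvg (P := F.P K) (j := k) ℰp) (j + 1) U₁)))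
                (emb (blockOf x)) x)⁻¹ *
              g₀ (j + 1) (blockOf x) * axialT (Averaging.iter (fun k => blockAvg (P := F.P K) (j := k) ℰp) j U₁) (emb (blockOf x)) x) ∧
          (∀ j, K - J ≤ j → ∀ y, g₀ j y = 1) ∧
          (∀ j, j < K - J → ∀ y : Site (F.P K) (j + 1), g₀ j (emb y) = g₀ (j + 1) y) ∧
          (∀ X : GaugeField (F.P K) 0 SU2, ∀ j, j ≤ K - J →
            Averaging.iter (fun k => blockAvg (P := F.P K) (j := k) ℰp) j (GaugeField.gaugeAct (g₀ 0) X) =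
              GaugeField.gaugeAct (g₀ j) (Averaging.iter (fun k => blockAvg (P := F.P K) (j := k) ℰp) j X)) ∧
          (∀ j, j < K - J → ∀ x,
            axialT (GaugeField.gaugeAct (g₀ j) (Averaging.iter (fun k => blockAvg (P := F.P K) (j := k) ℰp) j U₁)) (emb (blockOf x)) x =
              axialT (lift j (GaugeField.gaugeAct (g₀ (j + 1)) (Averaging.iter (fun k => blockAvg (P := F.P K) (j := k) ℰp) (j + 1) U₁)))
                (emb (blockOf x)) x) ∧
          (∀ j, j < K - J →
            (blockAvg (P := F.P K) (j := j) ℰp).avg (GaugeField.gaugeAct (g₀ j) (Averaging.iter (fun k => blockAvg (P := F.P K) (j := k) ℰp) j U₁)) =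
              GaugeField.gaugeAct (g₀ (j + 1)) (Averaging.iter (fun k => blockAvg (P := F.P K) (j := k) ℰp) (j + 1) U₁)) ∧
          (∀ X : GaugeField (F.P K) 0 SU2, Averaging.iter (fun k => blockAvg (P := F.P K) (j := k) ℰp) (K - J) (GaugeField.gaugeAct (fun x => (g 0 x)⁻¹) X) = Averaging.iter (fun k => blockAvg (P := F.P K) (j := k) ℰp) (K - J) X) ∧
          (∀ X : GaugeField (F.P K) 0 SU2, Averaging.iter (fun k => blockAvg (P := F.P K) (j := k) ℰp) (K - J) (GaugeField.gaugeAct (g₀ 0) X) = Averaging.iter (fun k => blockAvg (P := F.P K) (j := k) ℰp) (K - J) X) ∧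
          U₀ = GaugeField.gaugeAct (fun x => (g 0 x)⁻¹ * g₀ 0 x) U₁) →
        ((F.L : ℝ)⁻¹) ^ (2 * (K - J)) * ∑ ℓ : PBond (F.P K) 0, dist1 (U ℓ * (U₀ ℓ)⁻¹) ^ 2
          ≤ C_D * ∑ p : Plaq (F.P K) 0, (1 - reTr ((GaugeField.plaqHol U₀ p)⁻¹ * GaugeField.plaqHol U p)) := by
  intro L
  obtain ⟨c₀, hc₀, hc₀1, H1⟩ := HL L
  refine ⟨c₀, hc₀, hc₀1, fun cw hcw hcwle => ?_⟩
  obtain ⟨pS, H1⟩ := H1 cw hcw hcwle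
  refine ⟨pS, fun b₀ p₀ hb hpS hp => ?_⟩
  obtain ⟨ε₁, hε₁, H1⟩ := H1 b₀ p₀ hb hpS hp
  refine ⟨ε₁, hε₁, fun ε₀ hε₀ hε₀le => ?_⟩
  obtain ⟨γ₁, hγ₁, E, C, hC, H1⟩ := H1 ε₀ hε₀ hε₀le
  by_cases hL : 1 < L
  · have hL' : (1 : ℝ) < L := by exact_mod_cast hL
    have hCD : 0 < 2 * (Real.exp E * C / ((L : ℝ) - 1)) ^ 2 := by
      have : 0 < Real.exp E * C / ((L : ℝ) - 1) := div_pos (mul_pos (Real.exp_pos E) hC) (by linarith)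
      positivity
    refine ⟨γ₁, hγ₁, 2 * (Real.exp E * C / ((L : ℝ) - 1)) ^ 2, hCD, fun F γ hFL hγ hγle J K hJK V hV hG U₀ hU₀ U hU hUg hAx => ?_⟩
    obtain ⟨wt, lift, U₁, g, g₀, hw, hlift, h0, h1, h2, h3, h4, h5, h0', h1', h2', h3', h4', h5', hT6, hres', hEq⟩ := hAx
    have hFL' : (F.L : ℝ) = L := by exact_mod_cast hFL
    have hLF : 1 < (F.L : ℝ) := by rw [hFL']; exact hL'
    have hPd : (F.P K).d = 3 := rfl
    have hwres : ∀ X : GaugeField (F.P K) 0 SU2,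
        descendTo F ℰp J K hJK (GaugeField.gaugeAct (fun x => (g 0 x)⁻¹ * g₀ 0 x) X) = descendTo F ℰp J K hJK X := by
      refine residual_of_iter_eq F hJK _ fun X => ?_
      have e1 : GaugeField.gaugeAct (fun x => (g 0 x)⁻¹ * g₀ 0 x) X =
          GaugeField.gaugeAct (fun x => (g 0 x)⁻¹) (GaugeField.gaugeAct (g₀ 0) X) := by
        rw [← gaugeAct_mul_eq]; rfl
      rw [e1, hT6, hres']
    have hU₁ : U₁ ∈ {U' : GaugeField (F.P K) 0 (Matrix.specialUnitaryGroup (Fin 2) ℂ) | U' ∈ fibre F ℰp J K hJK V ∧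
        U' ∈ histGood F ℰp (θBal F.L γ b₀ p₀) K J ∧ wilsonAction4 U' = minActionRegPr F J K hJK ε₀ V} := by
      rw [hEq] at hU₀
      exact (gaugeAct_mem_argmin_iff_of_residual F hJK hwres U₁ V).mp hU₀
    have hletter := H1 F γ hFL hγ hγle J K hJK V hV hG U₁ hU₁ U hU hUg wt lift hw hlift g g₀
      h0 h1 h2 h3 h4 h5 h0' h1' h2' h3' h4' h5'
    have hR1 : ∀ j, j < K - J → ∀ X X' : GaugeField (F.P K) (j + 1) SU2,
        ∑ b, dist1 (lift j X b * (lift j X' b)⁻¹) ^ 2 ≤ (F.L : ℝ) * ∑ e, ‖logVec (su2Quat (X e)) - logVec (su2Quat (X' e))‖ ^ 2 := by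
      intro j hj X X'
      have hj' : j + 1 ≤ (F.P K).m + (F.P K).K := by show j + 1 ≤ F.m + K; omega
      have h := sum_dist1_sq_lift_mul_inv_le hj' (wt j) (hw j) X X' (lift j X) (lift j X') (hlift j X) (hlift j X')
      have hL0 : ((F.P K).L : ℝ) ≠ 0 := (Nat.cast_pos.mpr (F.P K).L_pos).ne'
      rw [hPd, show (((F.P K).L : ℝ)⁻¹) ^ 2 * ((F.P K).L : ℝ) ^ 3 = (F.P K).L by field_simp] at h
      exact h
    have h := (dockRel_of_towers F hJK hLF U U₁ hU hU₁.1 lift hR1 C E hC g g₀ h1 h1' hT6 hres' hletter).2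
    rw [← hEq] at h
    rw [hFL'] at h ⊢
    exact h
  · exact ⟨γ₁, hγ₁, 1, one_pos, fun F γ hFL => absurd (hFL ▸ F.hL.2) hL⟩

end Summit.QuantumFields.YangMills.Theorems.FluctuationComparisonRegPrIntLS2BetaStageAxialLetters

end
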